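import Summits.QuantumFields.YangMills.Theorems.SwapVirialDeficitSectorLaplaceEndGaussN2
import Summits.QuantumFields.YangMills.Theorems.SwapVirialDeficitSectorLaplaceBulkFibredBox
import HarnessLib

/-!
# N2 OF `stub_end_gaussCore`: THE THRESHOLD TAILS ARE `exp(C·L¹⁴ − b·τ²·ρ/(Q·L⁴⁶))`
# (free-hands support of ⟨stmt-QuantumFields-24197⟩ `SwapVirialDeficit.SwapGluedStiffness`; LEAD g99, memo11d / g49's plug socket)

The tail `T = T_far + T_1 + T_2` of ✓`endGauss_N2_glue` (written VERBATIM as there) is bounded, for `b ≥ 1`, `12τ² ≤ 1` and any common floor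
`0 < ρ ≤ 1` of the three thresholds (`ρ ≤ sT²`, `ρ ≤ κf/(300L⁴)`, `ρ ≤ r²`), by `ofReal (exp (250000·L¹⁴ − b·τ²·ρ/((2304·2484000²·13824³)·L⁴⁶)))` —
the shape `exp(CT·L^pT − b·τ^qT/(QT·L^pT))` of g49's socket `stub_end_gaussCore_of_N2` after the parameter choice `ρ = ρ₀/L^k`.
Ingredients: ✓`integral_piWeight`/✓`pi_sq_pow_card_fol_le_exp`, ✓`integral_piWeight_gnoFolBlocks_le_exp`, ✓`card_fol_real_le`, `9 ≤ d = 3|Fol L|`, `x + 1 ≤ eˣ`.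

HONEST LABEL: bookkeeping; the memo-ε plug of `stub_end_gaussCore`, `stub_core_tip`, ⟨24197⟩ ∕ ⟨24194⟩ remain OPEN; own crux ⟨22884⟩ OPEN (blocked-on ⟨19935⟩); the
Yang–Mills mass gap is NOT proved; no summit is proved by a line.  THEOREMS ONLY (0 `def`, 0 `sorry`, no instance), standard axioms.  `--supports stmt-QuantumFields-24197`.
References: [folklore].
-/

set_option autoImplicit false
set_option synthInstance.maxSize 1024

noncomputable section

open MeasureTheory Set Module
open scoped BigOperators ENNReal
open Literature.MathematicalPhysics.QuantumLattice
open Literature.MathematicalPhysics.QuantumFieldTheory hiding SU2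

namespace Summit.QuantumFields.YangMills.Theorems.SwapVirialDeficit.SectorLaplace

open Summit.QuantumFields.YangMills.Theorems.FemtoTransferGap
open Summit.QuantumFields.YangMills.Theorems.FemtoTransferGap.TT
open Summit.QuantumFields.YangMills.Theorems.VirialFluxGap.RingDeficit
open Summit.QuantumFields.YangMills.Theorems.SwapVirialDeficit.SwapRing
open Summit.QuantumFields.YangMills.Theorems.SwapVirialDeficit.BlowUpRing
open Summit.QuantumFields.YangMills.Theorems.SwapVirialDeficit.Gnomonic (gnomonicWeight piWeight piWeight_pos integrable_piWeight)

variable {L : ℕ} [NeZero L]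

/-- `μ_F⁻¹·2 = 2·2304L⁶|Fol L| ≤ 27648·L¹⁰` and `(13824L¹⁰)⁻¹ ≤ μ_F`. [folklore] -/
theorem folMu_ge_inv : (13824 * (L : ℝ) ^ 10)⁻¹ ≤ (2304 * (L : ℝ) ^ 6 * (Fintype.card (Fol L) : ℝ))⁻¹ ∧
    2 / (2304 * (L : ℝ) ^ 6 * (Fintype.card (Fol L) : ℝ))⁻¹ ≤ 27648 * (L : ℝ) ^ 10 := by
  have hL : (0 : ℝ) < L := by exact_mod_cast NeZero.pos L
  have hμ0 := (folMu_pos_le (L := L)).1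
  have hc := card_fol_real_le (L := L)
  have hle : 2304 * (L : ℝ) ^ 6 * (Fintype.card (Fol L) : ℝ) ≤ 13824 * (L : ℝ) ^ 10 := by
    calc 2304 * (L : ℝ) ^ 6 * (Fintype.card (Fol L) : ℝ) ≤ 2304 * (L : ℝ) ^ 6 * (6 * (L : ℝ) ^ 4) := by gcongr
      _ = 13824 * (L : ℝ) ^ 10 := by ring
  refine ⟨inv_anti₀ (inv_pos.1 hμ0) hle, ?_⟩
  rw [div_inv_eq_mul]; nlinarith

/-- The finrank `d = 3|Fol L|` satisfies `9 ≤ d ≤ 18L⁴`. [folklore] -/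
theorem finrank_gnoFol_le : (finrank ℝ (GnoFol L) : ℝ) ≤ 18 * (L : ℝ) ^ 4 := by
  rw [finrank_gnoFol_real]; have := card_fol_real_le (L := L); linarith

/-- `∫⁻ piWeight = ofReal((π²)^{|Fol L|}) ≤ ofReal(e^{60L⁴})`. [folklore] -/
theorem lintegral_piWeight_le_exp :
    ∫⁻ F : Fol L → Fin 3 → ℝ, ENNReal.ofReal (piWeight F) ≤ ENNReal.ofReal (Real.exp (60 * (L : ℝ) ^ 4)) := by
  rw [← ofReal_integral_eq_lintegral_ofReal integrable_piWeight (ae_of_all _ fun F => (piWeight_pos F).le), integral_piWeight]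
  exact ENNReal.ofReal_le_ofReal pi_sq_pow_card_fol_le_exp

/-- The Gaussian prefactor of the crude near tail: for `b ≥ 1`,
`(2π/((1−1/(2d))b))^{d/2} · (((μ_F/2)^d)⁻¹)^{1/2} ≤ exp(249000·L¹⁴)`. [folklore] -/
theorem folGauss_T2_prefactor_le {b : ℝ} (hb : 1 ≤ b) :
    (2 * Real.pi / ((1 - 1 / (2 * (finrank ℝ (GnoFol L) : ℝ))) * b)) ^ ((finrank ℝ (GnoFol L) : ℝ) / 2) *
        (((2304 * (L : ℝ) ^ 6 * (Fintype.card (Fol L) : ℝ))⁻¹ / 2) ^ finrank ℝ (GnoFol L))⁻¹ ^ (1 / 2 : ℝ) ≤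
      Real.exp (249000 * (L : ℝ) ^ 14) := by
  have hL : (0 : ℝ) < L := by exact_mod_cast NeZero.pos L
  have hL1 : (1 : ℝ) ≤ L := by exact_mod_cast Nat.one_le_iff_ne_zero.2 (NeZero.ne L)
  set μ : ℝ := (2304 * (L : ℝ) ^ 6 * (Fintype.card (Fol L) : ℝ))⁻¹ with hμ
  set d : ℝ := (finrank ℝ (GnoFol L) : ℝ) with hd
  have hμ0 : 0 < μ := (folMu_pos_le (L := L)).1
  have hd9 : 9 ≤ d := nine_le_finrank_gnoFol (L := L)
  have hd18 : d ≤ 18 * (L : ℝ) ^ 4 := finrank_gnoFol_le (L := L)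
  have h2μ : 2 / μ ≤ 27648 * (L : ℝ) ^ 10 := (folMu_ge_inv (L := L)).2
  -- first factor ≤ exp(4d)
  have hden : 17 / 18 ≤ (1 - 1 / (2 * d)) * b := by
    have h1 : 17 / 18 ≤ 1 - 1 / (2 * d) := by
      have : 1 / (2 * d) ≤ 1 / 18 := one_div_le_one_div_of_le (by norm_num) (by linarith)
      linarith
    calc (17 / 18 : ℝ) = 17 / 18 * 1 := by ring
      _ ≤ (1 - 1 / (2 * d)) * b := mul_le_mul h1 hb zero_le_one (by linarith)
  have hB : 2 * Real.pi / ((1 - 1 / (2 * d)) * b) ≤ Real.exp 8 := by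
    have hπ := Real.pi_le_four
    have h1 : 2 * Real.pi / ((1 - 1 / (2 * d)) * b) ≤ 8 / (17 / 18) :=
      div_le_div₀ (by norm_num) (by linarith) (by norm_num) hden
    have h2 : (8 / (17 / 18) : ℝ) ≤ Real.exp 8 := by have := Real.add_one_le_exp (8 : ℝ); norm_num at this ⊢; linarith
    exact h1.trans h2
  have hB0 : 0 ≤ 2 * Real.pi / ((1 - 1 / (2 * d)) * b) := div_nonneg (by positivity) (by linarith)
  have hG : (2 * Real.pi / ((1 - 1 / (2 * d)) * b)) ^ (d / 2) ≤ Real.exp (4 * d) := by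
    calc (2 * Real.pi / ((1 - 1 / (2 * d)) * b)) ^ (d / 2) ≤ (Real.exp 8) ^ (d / 2) := Real.rpow_le_rpow hB0 hB (by linarith)
      _ = Real.exp (4 * d) := by rw [← Real.exp_mul]; ring_nf
  -- second factor ≤ exp(13824·L¹⁰·d)
  have hP0 : 0 ≤ ((μ / 2) ^ finrank ℝ (GnoFol L))⁻¹ := by positivity
  have hP : ((μ / 2) ^ finrank ℝ (GnoFol L))⁻¹ ≤ Real.exp (27648 * (L : ℝ) ^ 10) ^ finrank ℝ (GnoFol L) := by
    rw [← inv_pow]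
    refine pow_le_pow_left₀ (by positivity) ?_ _
    rw [inv_div]
    have := Real.add_one_le_exp (27648 * (L : ℝ) ^ 10)
    linarith
  have hP' : ((μ / 2) ^ finrank ℝ (GnoFol L))⁻¹ ^ (1 / 2 : ℝ) ≤ Real.exp (13824 * (L : ℝ) ^ 10 * d) := by
    calc ((μ / 2) ^ finrank ℝ (GnoFol L))⁻¹ ^ (1 / 2 : ℝ) ≤ (Real.exp (27648 * (L : ℝ) ^ 10) ^ finrank ℝ (GnoFol L)) ^ (1 / 2 : ℝ) :=
          Real.rpow_le_rpow hP0 hP (by norm_num)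
      _ = Real.exp (13824 * (L : ℝ) ^ 10 * d) := by
          rw [← Real.exp_nat_mul, ← Real.exp_mul, hd]; ring_nf
  have hG0 : 0 ≤ (2 * Real.pi / ((1 - 1 / (2 * d)) * b)) ^ (d / 2) := Real.rpow_nonneg hB0 _
  calc (2 * Real.pi / ((1 - 1 / (2 * d)) * b)) ^ (d / 2) * ((μ / 2) ^ finrank ℝ (GnoFol L))⁻¹ ^ (1 / 2 : ℝ)
      ≤ Real.exp (4 * d) * Real.exp (13824 * (L : ℝ) ^ 10 * d) := mul_le_mul hG hP' (Real.rpow_nonneg hP0 _) (Real.exp_pos _).le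
    _ = Real.exp (4 * d + 13824 * (L : ℝ) ^ 10 * d) := by rw [← Real.exp_add]
    _ ≤ Real.exp (249000 * (L : ℝ) ^ 14) := by
        refine Real.exp_le_exp.2 ?_
        have h4 : (L : ℝ) ^ 4 ≤ (L : ℝ) ^ 14 := pow_le_pow_right₀ hL1 (by norm_num)
        have h14 : (L : ℝ) ^ 10 * (L : ℝ) ^ 4 = (L : ℝ) ^ 14 := by ring
        nlinarith [pow_pos hL 10, pow_pos hL 4]

/-- The common rate: with `Q₁ = 2304·2484000²·13824³` and `R = b·τ²·ρ/(Q₁·L⁴⁶)`, each of the three tail rates of ✓`endGauss_N2_glue` is `≥ R`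
(`12τ² ≤ 1`, `b ≥ 0`, `0 ≤ ρ ≤ 1`, `ρ ≤ sT²`, `ρ ≤ κf/(300L⁴)`, `ρ ≤ r²`). [folklore] -/
theorem endGauss_tail_rates_ge {τ b r sT κf ρ : ℝ} (hτ1 : 12 * τ ^ 2 ≤ 1) (hb : 0 ≤ b) (hρ0 : 0 ≤ ρ) (hρ1 : ρ ≤ 1)
    (hρs : ρ ≤ sT ^ 2) (hρκ : ρ ≤ κf / (300 * (L : ℝ) ^ 4)) (hρr : ρ ≤ r ^ 2) :
    b * τ ^ 2 * ρ / ((2304 * 2484000 ^ 2 * 13824 ^ 3) * (L : ℝ) ^ 46) ≤ 5 * b / 6 * (min (sT ^ 2) (κf / (300 * (L : ℝ) ^ 4)) / (3600 * (L : ℝ) ^ 6)) ∧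
    b * τ ^ 2 * ρ / ((2304 * 2484000 ^ 2 * 13824 ^ 3) * (L : ℝ) ^ 46) ≤
      b * ((2304 * (L : ℝ) ^ 6 * (Fintype.card (Fol L) : ℝ))⁻¹ *
        (3 * ((2304 * (L : ℝ) ^ 6 * (Fintype.card (Fol L) : ℝ))⁻¹ / 2) / (2 * (finrank ℝ (GnoFol L) : ℝ) * (2484000 * (L : ℝ) ^ 4))) ^ 2 / 4) ∧
    b * τ ^ 2 * ρ / ((2304 * 2484000 ^ 2 * 13824 ^ 3) * (L : ℝ) ^ 46) ≤ 5 * b / 6 * (min (12 * τ ^ 2) 1 * (r ^ 2 / 18) / (55200 * (L : ℝ) ^ 6)) := by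
  have hL : (0 : ℝ) < L := by exact_mod_cast NeZero.pos L
  have hL1 : (1 : ℝ) ≤ L := by exact_mod_cast Nat.one_le_iff_ne_zero.2 (NeZero.ne L)
  set μ : ℝ := (2304 * (L : ℝ) ^ 6 * (Fintype.card (Fol L) : ℝ))⁻¹ with hμ
  set d : ℝ := (finrank ℝ (GnoFol L) : ℝ) with hd
  set Q : ℝ := (2304 * 2484000 ^ 2 * 13824 ^ 3) * (L : ℝ) ^ 46 with hQ
  have hμ0 : 0 < μ := (folMu_pos_le (L := L)).1
  have hd9 : 9 ≤ d := nine_le_finrank_gnoFol (L := L)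
  have hd18 : d ≤ 18 * (L : ℝ) ^ 4 := finrank_gnoFol_le (L := L)
  have hμlow : (13824 * (L : ℝ) ^ 10)⁻¹ ≤ μ := (folMu_ge_inv (L := L)).1
  have hτ2 : τ ^ 2 ≤ 1 := by nlinarith [sq_nonneg τ]
  have hQ0 : 0 < Q := by positivity
  have h46 : (L : ℝ) ^ 6 ≤ (L : ℝ) ^ 46 := pow_le_pow_right₀ hL1 (by norm_num)
  -- R ≤ bρ/Q ≤ b/Q
  have hR1 : b * τ ^ 2 * ρ / Q ≤ b * ρ / Q :=
    div_le_div_of_nonneg_right (by nlinarith [mul_nonneg hb hρ0]) hQ0.le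
  have hR2 : b * τ ^ 2 * ρ / Q ≤ b / Q :=
    hR1.trans (div_le_div_of_nonneg_right (by nlinarith) hQ0.le)
  refine ⟨?_, ?_, ?_⟩
  · -- far
    have hm : ρ ≤ min (sT ^ 2) (κf / (300 * (L : ℝ) ^ 4)) := le_min hρs hρκ
    have h1 : b * ρ / Q ≤ b * ρ / (4320 * (L : ℝ) ^ 6) :=
      div_le_div_of_nonneg_left (mul_nonneg hb hρ0) (by positivity) (by rw [hQ]; nlinarith [pow_pos hL 6])
    have h2 : b * ρ / (4320 * (L : ℝ) ^ 6) ≤ 5 * b / 6 * (min (sT ^ 2) (κf / (300 * (L : ℝ) ^ 4)) / (3600 * (L : ℝ) ^ 6)) := by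
      have : 5 * b / 6 * (min (sT ^ 2) (κf / (300 * (L : ℝ) ^ 4)) / (3600 * (L : ℝ) ^ 6)) =
          b * min (sT ^ 2) (κf / (300 * (L : ℝ) ^ 4)) / (4320 * (L : ℝ) ^ 6) := by
        field_simp; ring
      rw [this]
      exact div_le_div_of_nonneg_right (mul_le_mul_of_nonneg_left hm hb) (by positivity)
    exact hR1.trans (h1.trans h2)
  · -- T1 (crude near)
    have hX0 : (0 : ℝ) < 2484000 * (L : ℝ) ^ 4 := by positivity
    have hf : 3 * (13824 * (L : ℝ) ^ 10)⁻¹ / (4 * (18 * (L : ℝ) ^ 4) * (2484000 * (L : ℝ) ^ 4)) ≤ 3 * (μ / 2) / (2 * d * (2484000 * (L : ℝ) ^ 4)) := by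
      have : 3 * (μ / 2) / (2 * d * (2484000 * (L : ℝ) ^ 4)) = 3 * μ / (4 * d * (2484000 * (L : ℝ) ^ 4)) := by
        field_simp; ring
      rw [this]
      exact div_le_div₀ (by positivity) (by linarith) (by positivity) (by gcongr)
    have hf0 : 0 ≤ 3 * (13824 * (L : ℝ) ^ 10)⁻¹ / (4 * (18 * (L : ℝ) ^ 4) * (2484000 * (L : ℝ) ^ 4)) := by positivity
    have hsq := pow_le_pow_left₀ hf0 hf 2
    have hprod : (13824 * (L : ℝ) ^ 10)⁻¹ * (3 * (13824 * (L : ℝ) ^ 10)⁻¹ / (4 * (18 * (L : ℝ) ^ 4) * (2484000 * (L : ℝ) ^ 4))) ^ 2 ≤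
        μ * (3 * (μ / 2) / (2 * d * (2484000 * (L : ℝ) ^ 4))) ^ 2 := mul_le_mul hμlow hsq (sq_nonneg _) hμ0.le
    have heq : b / Q = b * ((13824 * (L : ℝ) ^ 10)⁻¹ * (3 * (13824 * (L : ℝ) ^ 10)⁻¹ / (4 * (18 * (L : ℝ) ^ 4) * (2484000 * (L : ℝ) ^ 4))) ^ 2 / 4) := by
      rw [hQ]; field_simp; ring
    calc b * τ ^ 2 * ρ / Q ≤ b / Q := hR2
      _ = _ := heq
      _ ≤ b * (μ * (3 * (μ / 2) / (2 * d * (2484000 * (L : ℝ) ^ 4))) ^ 2 / 4) := by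
          exact mul_le_mul_of_nonneg_left (div_le_div_of_nonneg_right hprod (by norm_num)) hb
  · -- T2 (group far)
    rw [min_eq_left hτ1]
    have h1 : b * τ ^ 2 * ρ / Q ≤ b * τ ^ 2 * ρ / (99360 * (L : ℝ) ^ 6) :=
      div_le_div_of_nonneg_left (by nlinarith [mul_nonneg hb hρ0, sq_nonneg τ]) (by positivity) (by rw [hQ]; nlinarith [pow_pos hL 6])
    have h2 : b * τ ^ 2 * ρ / (99360 * (L : ℝ) ^ 6) ≤ 5 * b / 6 * (12 * τ ^ 2 * (r ^ 2 / 18) / (55200 * (L : ℝ) ^ 6)) := by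
      have : 5 * b / 6 * (12 * τ ^ 2 * (r ^ 2 / 18) / (55200 * (L : ℝ) ^ 6)) = b * τ ^ 2 * r ^ 2 / (99360 * (L : ℝ) ^ 6) := by
        field_simp; ring
      rw [this]
      exact div_le_div_of_nonneg_right (mul_le_mul_of_nonneg_left hρr (by nlinarith [sq_nonneg τ])) (by positivity)
    exact h1.trans h2

/-- ★ **THE TAILS OF N2 ARE `exp(250000·L¹⁴ − b·τ²·ρ/(Q₁·L⁴⁶))`.**  The tail `T = T_far + T_1 + T_2` of ✓`endGauss_N2_glue`, written verbatim, for `1 ≤ b`,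
`12τ² ≤ 1` and a common threshold floor `0 < ρ ≤ 1`, `ρ ≤ sT²`, `ρ ≤ κf/(300L⁴)`, `ρ ≤ r²`:
`T ≤ ofReal (exp (250000·L¹⁴ − b·τ²·ρ/((2304·2484000²·13824³)·L⁴⁶)))`. [folklore] -/
theorem endGauss_tails_le {τ b r sT κf ρ : ℝ} (hτ1 : 12 * τ ^ 2 ≤ 1) (hb : 1 ≤ b) (hρ0 : 0 ≤ ρ) (hρ1 : ρ ≤ 1)
    (hρs : ρ ≤ sT ^ 2) (hρκ : ρ ≤ κf / (300 * (L : ℝ) ^ 4)) (hρr : ρ ≤ r ^ 2) :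
    ENNReal.ofReal (Real.exp (-(5 * b / 6 * (min (sT ^ 2) (κf / (300 * (L : ℝ) ^ 4)) / (3600 * (L : ℝ) ^ 6))))) *
          (∫⁻ F : Fol L → Fin 3 → ℝ, ENNReal.ofReal (piWeight F)) +
        ENNReal.ofReal (Real.exp (-(b * ((2304 * (L : ℝ) ^ 6 * (Fintype.card (Fol L) : ℝ))⁻¹ *
            (3 * ((2304 * (L : ℝ) ^ 6 * (Fintype.card (Fol L) : ℝ))⁻¹ / 2) / (2 * (finrank ℝ (GnoFol L) : ℝ) * (2484000 * (L : ℝ) ^ 4))) ^ 2 / 4))) *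
          (∫ w : GnoFol L, piWeight (gnoFolBlocks w))) +
        ENNReal.ofReal (Real.exp (-(5 * b / 6 * (min (12 * τ ^ 2) 1 * (r ^ 2 / 18) / (55200 * (L : ℝ) ^ 6)))) *
          ((2 * Real.pi / ((1 - 1 / (2 * (finrank ℝ (GnoFol L) : ℝ))) * b)) ^ ((finrank ℝ (GnoFol L) : ℝ) / 2) *
            (((2304 * (L : ℝ) ^ 6 * (Fintype.card (Fol L) : ℝ))⁻¹ / 2) ^ finrank ℝ (GnoFol L))⁻¹ ^ (1 / 2 : ℝ))) ≤
      ENNReal.ofReal (Real.exp (250000 * (L : ℝ) ^ 14 - b * τ ^ 2 * ρ / ((2304 * 2484000 ^ 2 * 13824 ^ 3) * (L : ℝ) ^ 46))) := by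
  have hL : (0 : ℝ) < L := by exact_mod_cast NeZero.pos L
  have hL1 : (1 : ℝ) ≤ L := by exact_mod_cast Nat.one_le_iff_ne_zero.2 (NeZero.ne L)
  obtain ⟨hfar, hT1, hT2⟩ := endGauss_tail_rates_ge (L := L) hτ1 (zero_le_one.trans hb) hρ0 hρ1 hρs hρκ hρr
  set R : ℝ := b * τ ^ 2 * ρ / ((2304 * 2484000 ^ 2 * 13824 ^ 3) * (L : ℝ) ^ 46) with hR
  set Rfar : ℝ := 5 * b / 6 * (min (sT ^ 2) (κf / (300 * (L : ℝ) ^ 4)) / (3600 * (L : ℝ) ^ 6)) with hRfar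
  set R1 : ℝ := b * ((2304 * (L : ℝ) ^ 6 * (Fintype.card (Fol L) : ℝ))⁻¹ *
      (3 * ((2304 * (L : ℝ) ^ 6 * (Fintype.card (Fol L) : ℝ))⁻¹ / 2) / (2 * (finrank ℝ (GnoFol L) : ℝ) * (2484000 * (L : ℝ) ^ 4))) ^ 2 / 4) with hR1
  set R2 : ℝ := 5 * b / 6 * (min (12 * τ ^ 2) 1 * (r ^ 2 / 18) / (55200 * (L : ℝ) ^ 6)) with hR2
  set P : ℝ := (2 * Real.pi / ((1 - 1 / (2 * (finrank ℝ (GnoFol L) : ℝ))) * b)) ^ ((finrank ℝ (GnoFol L) : ℝ) / 2) *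
      (((2304 * (L : ℝ) ^ 6 * (Fintype.card (Fol L) : ℝ))⁻¹ / 2) ^ finrank ℝ (GnoFol L))⁻¹ ^ (1 / 2 : ℝ) with hP
  have hPle : P ≤ Real.exp (249000 * (L : ℝ) ^ 14) := folGauss_T2_prefactor_le (L := L) hb
  have hP0 : 0 ≤ P := mul_nonneg (Real.rpow_nonneg (div_nonneg (by positivity) (mul_nonneg (by
      have hd9 := nine_le_finrank_gnoFol (L := L)
      have : 1 / (2 * (finrank ℝ (GnoFol L) : ℝ)) ≤ 1 := by rw [div_le_iff₀ (by positivity)]; linarith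
      linarith) (by linarith))) _) (Real.rpow_nonneg (by positivity) _)
  have hW := integral_piWeight_gnoFolBlocks_le_exp (L := L)
  have hW0 : 0 ≤ ∫ w : GnoFol L, piWeight (gnoFolBlocks w) := integral_nonneg fun w => (piWeight_pos _).le
  -- the three pieces in ℝ≥0∞
  have e60 : Real.exp (60 * (L : ℝ) ^ 4) ≤ Real.exp (249000 * (L : ℝ) ^ 14) := by
    refine Real.exp_le_exp.2 ?_
    have h4 : (L : ℝ) ^ 4 ≤ (L : ℝ) ^ 14 := pow_le_pow_right₀ hL1 (by norm_num)
    nlinarith [pow_pos hL 4]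
  have piece : ∀ {Rx Wx : ℝ}, R ≤ Rx → 0 ≤ Wx → Wx ≤ Real.exp (249000 * (L : ℝ) ^ 14) →
      Real.exp (-Rx) * Wx ≤ Real.exp (249000 * (L : ℝ) ^ 14 - R) := by
    intro Rx Wx hRx hWx0 hWx
    calc Real.exp (-Rx) * Wx ≤ Real.exp (-R) * Real.exp (249000 * (L : ℝ) ^ 14) :=
          mul_le_mul (Real.exp_le_exp.2 (by linarith)) hWx hWx0 (Real.exp_pos _).le
      _ = Real.exp (249000 * (L : ℝ) ^ 14 - R) := by rw [← Real.exp_add]; ring_nf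
  have hA : ENNReal.ofReal (Real.exp (-Rfar)) * (∫⁻ F : Fol L → Fin 3 → ℝ, ENNReal.ofReal (piWeight F)) ≤
      ENNReal.ofReal (Real.exp (249000 * (L : ℝ) ^ 14 - R)) := by
    calc ENNReal.ofReal (Real.exp (-Rfar)) * (∫⁻ F : Fol L → Fin 3 → ℝ, ENNReal.ofReal (piWeight F))
        ≤ ENNReal.ofReal (Real.exp (-Rfar)) * ENNReal.ofReal (Real.exp (60 * (L : ℝ) ^ 4)) := mul_le_mul' le_rfl lintegral_piWeight_le_exp
      _ = ENNReal.ofReal (Real.exp (-Rfar) * Real.exp (60 * (L : ℝ) ^ 4)) := by rw [← ENNReal.ofReal_mul (Real.exp_pos _).le]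
      _ ≤ ENNReal.ofReal (Real.exp (249000 * (L : ℝ) ^ 14 - R)) := ENNReal.ofReal_le_ofReal (piece hfar (Real.exp_pos _).le e60)
  have hB : ENNReal.ofReal (Real.exp (-R1) * ∫ w : GnoFol L, piWeight (gnoFolBlocks w)) ≤ ENNReal.ofReal (Real.exp (249000 * (L : ℝ) ^ 14 - R)) :=
    ENNReal.ofReal_le_ofReal (piece hT1 hW0 (hW.trans e60))
  have hC : ENNReal.ofReal (Real.exp (-R2) * P) ≤ ENNReal.ofReal (Real.exp (249000 * (L : ℝ) ^ 14 - R)) :=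
    ENNReal.ofReal_le_ofReal (piece hT2 hP0 hPle)
  have h3 : 3 * Real.exp (249000 * (L : ℝ) ^ 14 - R) ≤ Real.exp (250000 * (L : ℝ) ^ 14 - R) := by
    have h3e : (3 : ℝ) ≤ Real.exp (1000 * (L : ℝ) ^ 14) := by
      have := Real.add_one_le_exp (1000 * (L : ℝ) ^ 14)
      nlinarith [one_le_pow₀ (n := 14) hL1]
    calc 3 * Real.exp (249000 * (L : ℝ) ^ 14 - R) ≤ Real.exp (1000 * (L : ℝ) ^ 14) * Real.exp (249000 * (L : ℝ) ^ 14 - R) :=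
          mul_le_mul_of_nonneg_right h3e (Real.exp_pos _).le
      _ = Real.exp (250000 * (L : ℝ) ^ 14 - R) := by rw [← Real.exp_add]; ring_nf
  calc ENNReal.ofReal (Real.exp (-Rfar)) * (∫⁻ F : Fol L → Fin 3 → ℝ, ENNReal.ofReal (piWeight F)) +
        ENNReal.ofReal (Real.exp (-R1) * ∫ w : GnoFol L, piWeight (gnoFolBlocks w)) + ENNReal.ofReal (Real.exp (-R2) * P)
      ≤ ENNReal.ofReal (Real.exp (249000 * (L : ℝ) ^ 14 - R)) + ENNReal.ofReal (Real.exp (249000 * (L : ℝ) ^ 14 - R)) +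
          ENNReal.ofReal (Real.exp (249000 * (L : ℝ) ^ 14 - R)) := add_le_add (add_le_add hA hB) hC
    _ = ENNReal.ofReal (3 * Real.exp (249000 * (L : ℝ) ^ 14 - R)) := by
        rw [← ENNReal.ofReal_add (Real.exp_pos _).le (Real.exp_pos _).le, ← ENNReal.ofReal_add (by positivity) (Real.exp_pos _).le]; ring_nf
    _ ≤ ENNReal.ofReal (Real.exp (250000 * (L : ℝ) ^ 14 - R)) := ENNReal.ofReal_le_ofReal h3

/-- ★ **THE TAILS OF N2 FROM RATE FLOORS** (the form matching w3 g68's `endGauss_params`): for `1 ≤ b` and any `R` below the three tail rates of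
✓`endGauss_N2_glue` (`R ≤ R_far`, `R ≤ R_1`, `R ≤ R_2`, each written verbatim), `T_far + T_1 + T_2 ≤ ofReal (exp (250000·L¹⁴ − R))`. [folklore] -/
theorem endGauss_tails_le_of_rates {τ b r sT κf R : ℝ} (hb : 1 ≤ b)
    (hfar : R ≤ 5 * b / 6 * (min (sT ^ 2) (κf / (300 * (L : ℝ) ^ 4)) / (3600 * (L : ℝ) ^ 6)))
    (hT1 : R ≤ b * ((2304 * (L : ℝ) ^ 6 * (Fintype.card (Fol L) : ℝ))⁻¹ *
        (3 * ((2304 * (L : ℝ) ^ 6 * (Fintype.card (Fol L) : ℝ))⁻¹ / 2) / (2 * (finrank ℝ (GnoFol L) : ℝ) * (2484000 * (L : ℝ) ^ 4))) ^ 2 / 4))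
    (hT2 : R ≤ 5 * b / 6 * (min (12 * τ ^ 2) 1 * (r ^ 2 / 18) / (55200 * (L : ℝ) ^ 6))) :
    ENNReal.ofReal (Real.exp (-(5 * b / 6 * (min (sT ^ 2) (κf / (300 * (L : ℝ) ^ 4)) / (3600 * (L : ℝ) ^ 6))))) *
          (∫⁻ F : Fol L → Fin 3 → ℝ, ENNReal.ofReal (piWeight F)) +
        ENNReal.ofReal (Real.exp (-(b * ((2304 * (L : ℝ) ^ 6 * (Fintype.card (Fol L) : ℝ))⁻¹ *
            (3 * ((2304 * (L : ℝ) ^ 6 * (Fintype.card (Fol L) : ℝ))⁻¹ / 2) / (2 * (finrank ℝ (GnoFol L) : ℝ) * (2484000 * (L : ℝ) ^ 4))) ^ 2 / 4))) *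
          (∫ w : GnoFol L, piWeight (gnoFolBlocks w))) +
        ENNReal.ofReal (Real.exp (-(5 * b / 6 * (min (12 * τ ^ 2) 1 * (r ^ 2 / 18) / (55200 * (L : ℝ) ^ 6)))) *
          ((2 * Real.pi / ((1 - 1 / (2 * (finrank ℝ (GnoFol L) : ℝ))) * b)) ^ ((finrank ℝ (GnoFol L) : ℝ) / 2) *
            (((2304 * (L : ℝ) ^ 6 * (Fintype.card (Fol L) : ℝ))⁻¹ / 2) ^ finrank ℝ (GnoFol L))⁻¹ ^ (1 / 2 : ℝ))) ≤
      ENNReal.ofReal (Real.exp (250000 * (L : ℝ) ^ 14 - R)) := by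
  have hL : (0 : ℝ) < L := by exact_mod_cast NeZero.pos L
  have hL1 : (1 : ℝ) ≤ L := by exact_mod_cast Nat.one_le_iff_ne_zero.2 (NeZero.ne L)
  set Rfar : ℝ := 5 * b / 6 * (min (sT ^ 2) (κf / (300 * (L : ℝ) ^ 4)) / (3600 * (L : ℝ) ^ 6)) with hRfar
  set R1 : ℝ := b * ((2304 * (L : ℝ) ^ 6 * (Fintype.card (Fol L) : ℝ))⁻¹ *
      (3 * ((2304 * (L : ℝ) ^ 6 * (Fintype.card (Fol L) : ℝ))⁻¹ / 2) / (2 * (finrank ℝ (GnoFol L) : ℝ) * (2484000 * (L : ℝ) ^ 4))) ^ 2 / 4) with hR1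
  set R2 : ℝ := 5 * b / 6 * (min (12 * τ ^ 2) 1 * (r ^ 2 / 18) / (55200 * (L : ℝ) ^ 6)) with hR2
  set P : ℝ := (2 * Real.pi / ((1 - 1 / (2 * (finrank ℝ (GnoFol L) : ℝ))) * b)) ^ ((finrank ℝ (GnoFol L) : ℝ) / 2) *
      (((2304 * (L : ℝ) ^ 6 * (Fintype.card (Fol L) : ℝ))⁻¹ / 2) ^ finrank ℝ (GnoFol L))⁻¹ ^ (1 / 2 : ℝ) with hP
  have hPle : P ≤ Real.exp (249000 * (L : ℝ) ^ 14) := folGauss_T2_prefactor_le (L := L) hb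
  have hP0 : 0 ≤ P := mul_nonneg (Real.rpow_nonneg (div_nonneg (by positivity) (mul_nonneg (by
      have hd9 := nine_le_finrank_gnoFol (L := L)
      have : 1 / (2 * (finrank ℝ (GnoFol L) : ℝ)) ≤ 1 := by rw [div_le_iff₀ (by positivity)]; linarith
      linarith) (by linarith))) _) (Real.rpow_nonneg (by positivity) _)
  have hW := integral_piWeight_gnoFolBlocks_le_exp (L := L)
  have hW0 : 0 ≤ ∫ w : GnoFol L, piWeight (gnoFolBlocks w) := integral_nonneg fun w => (piWeight_pos _).le
  have e60 : Real.exp (60 * (L : ℝ) ^ 4) ≤ Real.exp (249000 * (L : ℝ) ^ 14) := by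
    refine Real.exp_le_exp.2 ?_
    have h4 : (L : ℝ) ^ 4 ≤ (L : ℝ) ^ 14 := pow_le_pow_right₀ hL1 (by norm_num)
    nlinarith [pow_pos hL 4]
  have piece : ∀ {Rx Wx : ℝ}, R ≤ Rx → 0 ≤ Wx → Wx ≤ Real.exp (249000 * (L : ℝ) ^ 14) →
      Real.exp (-Rx) * Wx ≤ Real.exp (249000 * (L : ℝ) ^ 14 - R) := by
    intro Rx Wx hRx hWx0 hWx
    calc Real.exp (-Rx) * Wx ≤ Real.exp (-R) * Real.exp (249000 * (L : ℝ) ^ 14) :=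
          mul_le_mul (Real.exp_le_exp.2 (by linarith)) hWx hWx0 (Real.exp_pos _).le
      _ = Real.exp (249000 * (L : ℝ) ^ 14 - R) := by rw [← Real.exp_add]; ring_nf
  have hA : ENNReal.ofReal (Real.exp (-Rfar)) * (∫⁻ F : Fol L → Fin 3 → ℝ, ENNReal.ofReal (piWeight F)) ≤
      ENNReal.ofReal (Real.exp (249000 * (L : ℝ) ^ 14 - R)) := by
    calc ENNReal.ofReal (Real.exp (-Rfar)) * (∫⁻ F : Fol L → Fin 3 → ℝ, ENNReal.ofReal (piWeight F))
        ≤ ENNReal.ofReal (Real.exp (-Rfar)) * ENNReal.ofReal (Real.exp (60 * (L : ℝ) ^ 4)) := mul_le_mul' le_rfl lintegral_piWeight_le_exp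
      _ = ENNReal.ofReal (Real.exp (-Rfar) * Real.exp (60 * (L : ℝ) ^ 4)) := by rw [← ENNReal.ofReal_mul (Real.exp_pos _).le]
      _ ≤ ENNReal.ofReal (Real.exp (249000 * (L : ℝ) ^ 14 - R)) := ENNReal.ofReal_le_ofReal (piece hfar (Real.exp_pos _).le e60)
  have hB : ENNReal.ofReal (Real.exp (-R1) * ∫ w : GnoFol L, piWeight (gnoFolBlocks w)) ≤ ENNReal.ofReal (Real.exp (249000 * (L : ℝ) ^ 14 - R)) :=
    ENNReal.ofReal_le_ofReal (piece hT1 hW0 (hW.trans e60))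
  have hC : ENNReal.ofReal (Real.exp (-R2) * P) ≤ ENNReal.ofReal (Real.exp (249000 * (L : ℝ) ^ 14 - R)) :=
    ENNReal.ofReal_le_ofReal (piece hT2 hP0 hPle)
  have h3 : 3 * Real.exp (249000 * (L : ℝ) ^ 14 - R) ≤ Real.exp (250000 * (L : ℝ) ^ 14 - R) := by
    have h3e : (3 : ℝ) ≤ Real.exp (1000 * (L : ℝ) ^ 14) := by
      have := Real.add_one_le_exp (1000 * (L : ℝ) ^ 14)
      nlinarith [one_le_pow₀ (n := 14) hL1]
    calc 3 * Real.exp (249000 * (L : ℝ) ^ 14 - R) ≤ Real.exp (1000 * (L : ℝ) ^ 14) * Real.exp (249000 * (L : ℝ) ^ 14 - R) :=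
          mul_le_mul_of_nonneg_right h3e (Real.exp_pos _).le
      _ = Real.exp (250000 * (L : ℝ) ^ 14 - R) := by rw [← Real.exp_add]; ring_nf
  calc ENNReal.ofReal (Real.exp (-Rfar)) * (∫⁻ F : Fol L → Fin 3 → ℝ, ENNReal.ofReal (piWeight F)) +
        ENNReal.ofReal (Real.exp (-R1) * ∫ w : GnoFol L, piWeight (gnoFolBlocks w)) + ENNReal.ofReal (Real.exp (-R2) * P)
      ≤ ENNReal.ofReal (Real.exp (249000 * (L : ℝ) ^ 14 - R)) + ENNReal.ofReal (Real.exp (249000 * (L : ℝ) ^ 14 - R)) +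
          ENNReal.ofReal (Real.exp (249000 * (L : ℝ) ^ 14 - R)) := add_le_add (add_le_add hA hB) hC
    _ = ENNReal.ofReal (3 * Real.exp (249000 * (L : ℝ) ^ 14 - R)) := by
        rw [← ENNReal.ofReal_add (Real.exp_pos _).le (Real.exp_pos _).le, ← ENNReal.ofReal_add (by positivity) (Real.exp_pos _).le]; ring_nf
    _ ≤ ENNReal.ofReal (Real.exp (250000 * (L : ℝ) ^ 14 - R)) := ENNReal.ofReal_le_ofReal h3

end Summit.QuantumFields.YangMills.Theorems.SwapVirialDeficit.SectorLaplace

end
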